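import Literature.NumberTheory.EllipticCurves.DeShalit1987.RayClassTower
import Literature.NumberTheory.NumberFields.RayClassFieldAdicTowerRefine
import Literature.NumberTheory.EllipticCurves.ProfiniteGroupDistributionRing
import Literature.NumberTheory.EllipticCurves.PAdicTwoVariableTransformCharacter
import HarnessLib

/-!
# Uniqueness of the `j = 0` Katz–de Shalit measure on `Γ_K`, I: cells of the tower against the `v`-ray
# cosets `τ·Gal(K̄/K(𝔣′v^{n+1}))`, the difference distribution, and the coordinate `σ ↦ e(κ_v(τ⁻¹σ))⁻¹`
# (de Shalit 1987, II.4.12 Remark (iv): "the measure is unique"; II.4.17)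

Cell `bsd-print-cf2`, width seat `bsd-line-cf2-p1-w5` g15; construction lane of the print leaf
`KatzDistributionsAtTwoPrint` (stmt-BirchSwinnertonDyer-24720): the LEAD's (T4a) "uniqueness of the
`j = 0` measure" (card `Cruxes/KatzDistributionsAtTwoPrint/Lines/katz_measure_two.md` v2.2, brick 2),
PLUMBING half. Theorems only; no `sorry`; nothing is closed by this file; BSD is not proved by any of this.

De Shalit II.4.12 Remark (iv) (p. 67): a measure on `𝒢 = Gal(K(𝔣p^∞)/K)` is determined by its integrals
against the `p`-adic characters in the range; II.4.17 (p. 77–78): those integrals are read on the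
`ℤ_p`-quotients cut out by the `𝔭`-adic characters. To turn "all test integrals of `ν = μ − μ′` vanish"
into "`ν = 0` on every cell of the tower `𝒰`" one needs, over any group `G`:

* §1 `integral_add_smul_neg_one`, `add_smul_neg_one_μ` — the difference distribution
  `ν = μ + (−1)•μ′` (`ProfiniteGroupDistributionRing.lean`): `∫ f dν = ∫ f dμ − ∫ f dμ′`, `ν(a) = μ(a) − μ′(a)`;
* §2 `isTowerContinuous_ite_mem_leftCoset` — the indicator of a left coset `τW` of a subgroup `W`
  containing some level `U_N` is tower-continuous; ★ `μ_eq_zero_of_forall_integral_leftCoset_eq_zero` —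
  if every `∫ 𝟙_{τW} dν` vanishes for a subgroup `W ≤ U_N`, then `ν` vanishes on every level-`N` cell
  (a cell is a finite disjoint union of `W`-cosets, `Subgroup.quotientMapOfLE`);

and, over a number field `K` (totally complex, `𝔪₀ ≠ 0`, `v ∤ 𝔪₀`, `w_{𝔪₀} = 1`, `κ = κ_v` the `v`-adic
Artin character of `Gal(K̄/K(𝔪₀))`, `e : 𝒪_v ≃+* ℤ_p`):

* §3 the coordinate `z_τ(σ) = e(κ(τ⁻¹σ)⁻¹)` on the coset `τ·Gal(K̄/K(𝔪₀))` (`0` off it):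
  `isUnit_coord`, `padicIntCast_coord` (`= (e(κ(τ⁻¹σ)))⁻¹` read in `𝕜`), ★ `toZModPow_coord_eq_one_iff`
  (`z_τ(σ) ≡ 1 (p^{n+1}) ⟺ τ⁻¹σ ∈ Gal(K̄/K(𝔪₀v^{n+1}))`), ★ `isTowerContinuous_coord` (along any tower of
  open subgroups with `⋂ U_n ⊆ rayKer K p S`, `𝔪₀` supported on `S ∪ {w ∣ p}`), and
  ★★ `ite_mem_absRayAdicTower_eq` — for `𝔣′ ⊆ 𝔪₀`, `v ∤ 𝔣′`:
  **`𝟙_{τ·Gal(K̄/K(𝔣′v^{n+1}))}(σ) = 𝟙_{z_τ(σ) ≡ 1 (p^{n+1})} · 𝟙_{τ·Gal(K̄/K(𝔣′))}(σ)`**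
  (`Gal(K̄/K(𝔣′v^{n+1})) = Gal(K̄/K(𝔪₀v^{n+1})) ∩ Gal(K̄/K(𝔣′))`, -w8 `absRayAdicTower_U_eq_inf`) — the
  shape consumed by `GroupDistribution.integral_ite_toZModPow_comp_mul_eq_zero_of_forall_le`
  (`ProfiniteGroupDistributionPushforwardPadic.lean`).

## References

* [deShalit1987] E. de Shalit, *Iwasawa theory of elliptic curves with complex multiplication* (1987),
  I.3.1 (p. 15–16), II.1.9 (p. 43), II.4.12 Remark (iv) (p. 67), II.4.17 (p. 77–78).
-/

noncomputable section

namespace Summit.BirchSwinnertonDyer.BirchSwinnertonDyer.Theorems.PrintCf2.KatzJZeroUnique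

open scoped NumberField Topology Classical
open NumberField IsDedekindDomain IsDedekindDomain.HeightOneSpectrum Field Filter
open Literature.NumberTheory.EllipticCurves Literature.NumberTheory.GaloisRepresentations
open Literature.NumberTheory.NumberFields

set_option linter.dupNamespace false -- D-0017: single-problem summit, `…BirchSwinnertonDyer.BirchSwinnertonDyer…` repeats a namespace by design
set_option autoImplicit false

/-! ### §1. The difference distribution `ν = μ + (−1)•μ′` -/

section Difference

variable {G : Type*} [Group G] {𝒰 : SubgroupTower G} {𝕜 : Type*} [NormedField 𝕜] [IsUltrametricDist 𝕜]
  [CompleteSpace 𝕜] (μ μ' : GroupDistribution 𝒰 𝕜)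

/-- `∫ f d(μ + (−1)•μ′) = ∫ f dμ − ∫ f dμ′` for tower-continuous `f`. [cite: deShalit1987, I.3.1 (p. 15–16)] -/
theorem integral_add_smul_neg_one {f : G → 𝕜} (hf : 𝒰.IsTowerContinuous f) :
    (GroupDistribution.add μ (GroupDistribution.smul (-1) μ')).integral f = μ.integral f - μ'.integral f := by
  rw [GroupDistribution.integral_add_distribution _ _ hf, GroupDistribution.integral_smul _ _ hf, neg_one_mul,
    sub_eq_add_neg]

omit [CompleteSpace 𝕜] in
/-- The level data of `μ + (−1)•μ′` are `μ(a) − μ′(a)`. [cite: deShalit1987, I.3.1 (p. 15–16)] -/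
theorem add_smul_neg_one_μ (n : ℕ) (a : G ⧸ 𝒰.U n) :
    (GroupDistribution.add μ (GroupDistribution.smul (-1) μ')).μ n a = μ.μ n a - μ'.μ n a := by
  rw [GroupDistribution.add_μ, GroupDistribution.smul_μ, neg_one_mul, sub_eq_add_neg]

/-- If the test integrals of `μ` and `μ′` agree then those of `ν = μ + (−1)•μ′` vanish.
[cite: deShalit1987, II.4.12 Remark (iv) (p. 67)] -/
theorem integral_add_smul_neg_one_eq_zero {f : G → 𝕜} (hf : 𝒰.IsTowerContinuous f)
    (h : μ.integral f = μ'.integral f) :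
    (GroupDistribution.add μ (GroupDistribution.smul (-1) μ')).integral f = 0 := by
  rw [integral_add_smul_neg_one μ μ' hf, h, sub_self]

end Difference

/-! ### §2. Cells of the tower as unions of cosets of a smaller subgroup -/

section Cosets

variable {G : Type*} [Group G] {𝒰 : SubgroupTower G} {𝕜 : Type*} [NormedField 𝕜]

/-- **The indicator of a left coset `τW` is tower-continuous** as soon as `W` contains some level `U_N`
(it is then constant on the `U_N`-cosets). [cite: deShalit1987, I.3.1 (p. 16)] -/
theorem isTowerContinuous_ite_mem_leftCoset {W : Subgroup G} {N : ℕ} (hN : 𝒰.U N ≤ W) (τ : G) :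
    𝒰.IsTowerContinuous (fun σ ↦ if τ⁻¹ * σ ∈ W then (1 : 𝕜) else 0) := by
  refine SubgroupTower.IsTowerContinuous.of_factorsThrough (m := N)
    (fun a ↦ if τ⁻¹ * 𝒰.repr N a ∈ W then (1 : 𝕜) else 0) fun σ ↦ ?_
  have hmem : σ⁻¹ * 𝒰.repr N (𝒰.proj N σ) ∈ W := hN (𝒰.proj_eq_iff.mp (𝒰.proj_repr N _).symm)
  have hiff : τ⁻¹ * σ ∈ W ↔ τ⁻¹ * 𝒰.repr N (𝒰.proj N σ) ∈ W := by
    have e : τ⁻¹ * 𝒰.repr N (𝒰.proj N σ) = (τ⁻¹ * σ) * (σ⁻¹ * 𝒰.repr N (𝒰.proj N σ)) := by group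
    rw [e]
    exact ⟨fun h ↦ W.mul_mem h hmem, fun h ↦ by simpa using W.mul_mem h (W.inv_mem hmem)⟩
  simp only [hiff]

/-- Membership in a left coset read on the quotient: `τ⁻¹σ ∈ W ⟺ σW = τW`. [folklore] -/
private theorem inv_mul_mem_iff_mk_eq (W : Subgroup G) (τ σ : G) :
    τ⁻¹ * σ ∈ W ↔ (QuotientGroup.mk σ : G ⧸ W) = QuotientGroup.mk τ := by
  rw [QuotientGroup.eq, ← W.inv_mem_iff, mul_inv_rev, inv_inv]

variable [IsUltrametricDist 𝕜] [CompleteSpace 𝕜] (D : GroupDistribution 𝒰 𝕜)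

omit [IsUltrametricDist 𝕜] [CompleteSpace 𝕜] in
/-- **A cell of level `N` is a finite disjoint union of `W`-cosets** (`W ≤ U_N` of finite index): the
cell indicator is the sum of the coset indicators over the `W`-cosets mapping to the cell.
[cite: deShalit1987, I.3.1 (p. 15–16)] -/
theorem ite_proj_eq_eq_sum {W : Subgroup G} [Fintype (G ⧸ W)] {N : ℕ} (hW : W ≤ 𝒰.U N)
    (a : G ⧸ 𝒰.U N) (σ : G) :
    (if 𝒰.proj N σ = a then (1 : 𝕜) else 0) =
      ∑ b ∈ (Finset.univ : Finset (G ⧸ W)).filter (fun b ↦ Subgroup.quotientMapOfLE hW b = a),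
        (if (QuotientGroup.mk σ : G ⧸ W) = b then (1 : 𝕜) else 0) := by
  rw [Finset.sum_filter, Finset.sum_eq_single (QuotientGroup.mk σ : G ⧸ W)]
  · rw [if_pos rfl, Subgroup.quotientMapOfLE_apply_mk]
    rfl
  · intro b _ hb
    rw [if_neg (Ne.symm hb), ite_self]
  · intro h
    exact absurd (Finset.mem_univ _) h

/-- ★ **Vanishing on cells from vanishing on cosets**: if `W ≤ U_N` contains some level `U_M` and every
`∫ 𝟙_{τW} dD` vanishes, then `D` vanishes on every level-`N` cell. [cite: deShalit1987, I.3.1 (p. 15–16), II.4.12 Remark (iv) (p. 67)] -/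
theorem μ_eq_zero_of_forall_integral_leftCoset_eq_zero {W : Subgroup G} [W.FiniteIndex] {N M : ℕ}
    (hW : W ≤ 𝒰.U N) (hM : 𝒰.U M ≤ W)
    (h : ∀ τ : G, D.integral (fun σ ↦ if τ⁻¹ * σ ∈ W then (1 : 𝕜) else 0) = 0) (a : G ⧸ 𝒰.U N) :
    D.μ N a = 0 := by
  haveI : Fintype (G ⧸ W) := Fintype.ofFinite _
  have hind : ∀ b : G ⧸ W, D.integral (fun σ ↦ if (QuotientGroup.mk σ : G ⧸ W) = b then (1 : 𝕜) else 0) = 0 := by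
    intro b
    induction b using QuotientGroup.induction_on with
    | H τ =>
      have := h τ
      simp_rw [inv_mul_mem_iff_mk_eq] at this
      exact this
  have hcont : ∀ b : G ⧸ W, 𝒰.IsTowerContinuous
      (fun σ ↦ if (QuotientGroup.mk σ : G ⧸ W) = b then (1 : 𝕜) else 0) := by
    intro b
    induction b using QuotientGroup.induction_on with
    | H τ =>
      simp_rw [← inv_mul_mem_iff_mk_eq]
      exact isTowerContinuous_ite_mem_leftCoset hM τ
  rw [← D.integral_indicator_cell N a,
    D.integral_congr (fun σ ↦ ite_proj_eq_eq_sum (𝕜 := 𝕜) hW a σ),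
    D.integral_finset_sum _ (fun b _ ↦ hcont b)]
  exact Finset.sum_eq_zero fun b _ ↦ hind b

end Cosets

/-! ### §3. The coordinate `z_τ(σ) = e(κ_v(τ⁻¹σ)⁻¹)` on a coset of `Gal(K̄/K(𝔪₀))` -/

section Coord

variable {p : ℕ} [Fact p.Prime] {K : Type} [Field K] [NumberField K] [IsTotallyComplex K]
  {𝔪₀ : Ideal (𝓞 K)} {v : HeightOneSpectrum (𝓞 K)} (h𝔪₀ : 𝔪₀ ≠ ⊥) (hv : ¬ 𝔪₀ ≤ v.asIdeal)
  (hw : ∀ u : (𝓞 K)ˣ, (u : 𝓞 K) - 1 ∈ 𝔪₀ → u = 1) (e : v.adicCompletionIntegers K ≃+* ℤ_[p])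

/-- **The coordinate `z_τ`**: `σ ↦ e(κ_v(τ⁻¹σ)⁻¹) ∈ ℤ_p` on the coset `τ·Gal(K̄/K(𝔪₀))`, `0` off it
(written inline; `κ_v = rayAdicCharacter h𝔪₀ hv hw`). Its value is a unit on the coset.
[cite: deShalit1987, II.1.9 (p. 43), II.4.17 (p. 77–78)] -/
theorem isUnit_coord (τ σ : absoluteGaloisGroup K)
    (h : τ⁻¹ * σ ∈ (absRestrictNormalHom (rayClassField K 𝔪₀)).ker) :
    IsUnit (if h' : τ⁻¹ * σ ∈ (absRestrictNormalHom (rayClassField K 𝔪₀)).ker then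
      e (((rayAdicCharacter h𝔪₀ hv hw ⟨τ⁻¹ * σ, h'⟩)⁻¹ : (v.adicCompletionIntegers K)ˣ) :
        v.adicCompletionIntegers K) else 0) := by
  rw [dif_pos h]
  exact (Units.isUnit _).map e

/-- On the coset, `z_τ(σ)` read in `𝕜` is the inverse of `e(κ_v(τ⁻¹σ))` read in `𝕜`.
[cite: deShalit1987, II.4.17 (p. 77–78)] -/
theorem padicIntCast_coord {𝕜 : Type*} [NormedField 𝕜] [NormedAlgebra ℚ_[p] 𝕜] (τ σ : absoluteGaloisGroup K)
    (h : τ⁻¹ * σ ∈ (absRestrictNormalHom (rayClassField K 𝔪₀)).ker) :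
    padicIntCast 𝕜 (if h' : τ⁻¹ * σ ∈ (absRestrictNormalHom (rayClassField K 𝔪₀)).ker then
      e (((rayAdicCharacter h𝔪₀ hv hw ⟨τ⁻¹ * σ, h'⟩)⁻¹ : (v.adicCompletionIntegers K)ˣ) :
        v.adicCompletionIntegers K) else 0) =
      (padicIntCast 𝕜 (e ((rayAdicCharacter h𝔪₀ hv hw ⟨τ⁻¹ * σ, h⟩ : (v.adicCompletionIntegers K)ˣ) :
        v.adicCompletionIntegers K)))⁻¹ := by
  rw [dif_pos h]
  set u := rayAdicCharacter h𝔪₀ hv hw ⟨τ⁻¹ * σ, h⟩ with hu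
  have hmul : padicIntCast 𝕜 (e ((u⁻¹ : (v.adicCompletionIntegers K)ˣ) : v.adicCompletionIntegers K)) *
      padicIntCast 𝕜 (e ((u : (v.adicCompletionIntegers K)ˣ) : v.adicCompletionIntegers K)) = 1 := by
    rw [← map_mul, ← map_mul, ← Units.val_mul, inv_mul_cancel, Units.val_one, map_one, map_one]
  have hne : padicIntCast 𝕜 (e ((u : (v.adicCompletionIntegers K)ˣ) : v.adicCompletionIntegers K)) ≠ 0 :=
    fun h0 ↦ by rw [h0, mul_zero] at hmul; exact zero_ne_one hmul
  exact (eq_inv_of_mul_eq_one_left hmul)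

/-- ★ **`z_τ(σ) ≡ 1 (mod p^{n+1}) ⟺ τ⁻¹σ ∈ Gal(K̄/K(𝔪₀v^{n+1}))`** on the coset (`κ_v ≡ 1 (mod v^{n+1})`
cuts out `K(𝔪₀v^{n+1})` inside `K(𝔪₀)`, `mem_ker_rayClassField_mul_pow_iff_valued`; a unit is `≡ 1` iff its
inverse is). [cite: deShalit1987, II.1.9 (p. 43)] [cite: NeukirchANT1999, Ch. VI §6 (6.7)] -/
theorem toZModPow_coord_eq_one_iff (τ σ : absoluteGaloisGroup K)
    (h : τ⁻¹ * σ ∈ (absRestrictNormalHom (rayClassField K 𝔪₀)).ker) (n : ℕ) :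
    PadicInt.toZModPow (n + 1) (if h' : τ⁻¹ * σ ∈ (absRestrictNormalHom (rayClassField K 𝔪₀)).ker then
      e (((rayAdicCharacter h𝔪₀ hv hw ⟨τ⁻¹ * σ, h'⟩)⁻¹ : (v.adicCompletionIntegers K)ˣ) :
        v.adicCompletionIntegers K) else 0) = 1 ↔
      τ⁻¹ * σ ∈ (absRayAdicTower h𝔪₀ v).U n := by
  rw [dif_pos h, mem_absRayAdicTower_U_iff,
    mem_ker_rayClassField_mul_pow_iff_valued h𝔪₀ hv hw ⟨τ⁻¹ * σ, h⟩ (n + 1),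
    ← toZModPow_map_eq_one_iff_valued e (n + 1)]
  set u := rayAdicCharacter h𝔪₀ hv hw ⟨τ⁻¹ * σ, h⟩ with hu
  -- `e(u⁻¹) ≡ 1 ⟺ e(u) ≡ 1`
  have hmul : PadicInt.toZModPow (n + 1) (e ((u⁻¹ : (v.adicCompletionIntegers K)ˣ) : v.adicCompletionIntegers K)) *
      PadicInt.toZModPow (n + 1) (e ((u : (v.adicCompletionIntegers K)ˣ) : v.adicCompletionIntegers K)) = 1 := by
    rw [← map_mul, ← map_mul, ← Units.val_mul, inv_mul_cancel, Units.val_one, map_one, map_one]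
  constructor
  · intro h1
    rw [h1, one_mul] at hmul
    exact hmul
  · intro h1
    rw [h1, mul_one] at hmul
    exact hmul

/-- `toZModPow k x = 1` gives `‖x − 1‖ ≤ p^{−k}`. [folklore] -/
private theorem norm_sub_one_le_of_toZModPow_eq_one {k : ℕ} {x : ℤ_[p]} (h : PadicInt.toZModPow k x = 1) :
    ‖x - 1‖ ≤ (p : ℝ) ^ (-(k : ℤ)) := by
  have hker : x - 1 ∈ RingHom.ker (PadicInt.toZModPow k : ℤ_[p] →+* ZMod (p ^ k)) := by
    rw [RingHom.mem_ker, map_sub, h, map_one, sub_self]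
  rwa [PadicInt.ker_toZModPow, ← PadicInt.norm_le_pow_iff_mem_span_pow] at hker

/-- ★ **The coordinate `z_τ` is tower-continuous** along every tower of open subgroups of `Γ_K` with
`⋂ U_n ⊆ rayKer K p S`, provided `𝔪₀` is supported on `S ∪ {w ∣ p}`: deep levels lie in
`Gal(K̄/K(𝔪₀v^k))`, on whose cosets `κ_v` is constant modulo `v^k`. [cite: deShalit1987, II.4.17 (p. 77–78)] -/
theorem isTowerContinuous_coord {S : Finset (HeightOneSpectrum (𝓞 K))}
    (hsupp : ∀ w : HeightOneSpectrum (𝓞 K), w ∉ S → ((p : ℕ) : 𝓞 K) ∉ w.asIdeal → ¬ 𝔪₀ ≤ w.asIdeal)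
    (hvp : ((p : ℕ) : 𝓞 K) ∈ v.asIdeal)
    {𝒰 : SubgroupTower (absoluteGaloisGroup K)} (hopen : ∀ n, IsOpen (𝒰.U n : Set (absoluteGaloisGroup K)))
    (hray : ⋂ n, (𝒰.U n : Set (absoluteGaloisGroup K)) ⊆ DeShalit1987.rayKer K p S)
    (τ : absoluteGaloisGroup K) :
    𝒰.IsTowerContinuous (fun σ ↦
      if h' : τ⁻¹ * σ ∈ (absRestrictNormalHom (rayClassField K 𝔪₀)).ker then
        e (((rayAdicCharacter h𝔪₀ hv hw ⟨τ⁻¹ * σ, h'⟩)⁻¹ : (v.adicCompletionIntegers K)ˣ) :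
          v.adicCompletionIntegers K) else (0 : ℤ_[p])) := by
  intro ε hε
  have hp1 : (1 : ℝ) < p := by exact_mod_cast (Fact.out : p.Prime).one_lt
  obtain ⟨k, hk⟩ := exists_pow_lt_of_lt_one hε (inv_lt_one_of_one_lt₀ hp1)
  -- the open subgroup `V = Gal(K̄/K(𝔪₀ v^k))` contains `rayKer`, hence some level `U_N`
  set V : Subgroup (absoluteGaloisGroup K) := (absRestrictNormalHom (rayClassField K (𝔪₀ * v.asIdeal ^ k))).ker
    with hVdef
  have hVsupp : ∀ w : HeightOneSpectrum (𝓞 K), w ∉ S → ((p : ℕ) : 𝓞 K) ∉ w.asIdeal →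
      ¬ 𝔪₀ * v.asIdeal ^ k ≤ w.asIdeal := by
    intro w hwS hwp hle
    rcases (w.isPrime.mul_le).mp hle with h1 | h1
    · exact hsupp w hwS hwp h1
    · have hvw : v = w := HeightOneSpectrum.ext (v.isMaximal.eq_of_le w.isPrime.ne_top (w.isPrime.le_of_pow_le h1))
      exact hwp (hvw ▸ hvp)
  have hrayV : (DeShalit1987.rayKer K p S : Set (absoluteGaloisGroup K)) ⊆ V :=
    SetLike.coe_subset_coe.mpr (DeShalit1987.rayKer_le_ker_absRestrictNormalHom_rayClassField p S
      (mul_ne_zero h𝔪₀ (pow_ne_zero _ v.ne_bot)) hVsupp)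
  obtain ⟨N, hN⟩ := 𝒰.exists_subset_of_isOpen hopen hray (isOpen_ker_absRestrictNormalHom _) hrayV
  have hVH : V ≤ (absRestrictNormalHom (rayClassField K 𝔪₀)).ker :=
    ker_absRestrictNormalHom_rayClassField_anti (mul_ne_zero h𝔪₀ (pow_ne_zero _ v.ne_bot)) Ideal.mul_le_right
  refine ⟨N, fun n hn σ σ' hσσ' ↦ ?_⟩
  have hδV : σ⁻¹ * σ' ∈ V := hN (𝒰.le_of_le hn (𝒰.proj_eq_iff.mp hσσ'))
  have hδH : σ⁻¹ * σ' ∈ (absRestrictNormalHom (rayClassField K 𝔪₀)).ker := hVH hδV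
  by_cases hσ : τ⁻¹ * σ ∈ (absRestrictNormalHom (rayClassField K 𝔪₀)).ker
  · have hσ' : τ⁻¹ * σ' ∈ (absRestrictNormalHom (rayClassField K 𝔪₀)).ker := by
      have e1 : τ⁻¹ * σ' = (τ⁻¹ * σ) * (σ⁻¹ * σ') := by group
      rw [e1]; exact Subgroup.mul_mem _ hσ hδH
    simp only [dif_pos hσ, dif_pos hσ']
    -- `κ(τ⁻¹σ') = κ(τ⁻¹σ)·κ(σ⁻¹σ')` and `κ(σ⁻¹σ') ≡ 1 (mod v^k)`
    have hprod : (⟨τ⁻¹ * σ', hσ'⟩ : ↥(absRestrictNormalHom (rayClassField K 𝔪₀)).ker) =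
        ⟨τ⁻¹ * σ, hσ⟩ * ⟨σ⁻¹ * σ', hδH⟩ := Subtype.ext (by simp only [Subgroup.coe_mul]; group)
    have hone : PadicInt.toZModPow k (e ((rayAdicCharacter h𝔪₀ hv hw ⟨σ⁻¹ * σ', hδH⟩ :
        (v.adicCompletionIntegers K)ˣ) : v.adicCompletionIntegers K)) = 1 :=
      (toZModPow_map_eq_one_iff_valued e k _).mpr
        ((mem_ker_rayClassField_mul_pow_iff_valued h𝔪₀ hv hw ⟨σ⁻¹ * σ', hδH⟩ k).mp hδV)
    -- hence the inverses are congruent too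
    set a : ℤ_[p] := e (((rayAdicCharacter h𝔪₀ hv hw ⟨τ⁻¹ * σ, hσ⟩)⁻¹ : (v.adicCompletionIntegers K)ˣ) :
      v.adicCompletionIntegers K) with ha
    set b : ℤ_[p] := e (((rayAdicCharacter h𝔪₀ hv hw ⟨σ⁻¹ * σ', hδH⟩)⁻¹ : (v.adicCompletionIntegers K)ˣ) :
      v.adicCompletionIntegers K) with hb
    have hab : e (((rayAdicCharacter h𝔪₀ hv hw ⟨τ⁻¹ * σ', hσ'⟩)⁻¹ : (v.adicCompletionIntegers K)ˣ) :
        v.adicCompletionIntegers K) = a * b := by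
      rw [hprod, map_mul, mul_inv, Units.val_mul, map_mul]
    have hb1 : PadicInt.toZModPow k b = 1 := by
      have hmul : PadicInt.toZModPow k b * PadicInt.toZModPow k (e ((rayAdicCharacter h𝔪₀ hv hw ⟨σ⁻¹ * σ', hδH⟩ :
          (v.adicCompletionIntegers K)ˣ) : v.adicCompletionIntegers K)) = 1 := by
        rw [hb, ← map_mul, ← map_mul, ← Units.val_mul, inv_mul_cancel, Units.val_one, map_one, map_one]
      rw [hone, mul_one] at hmul
      exact hmul
    have ha1 : ‖a‖ ≤ 1 := PadicInt.norm_le_one a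
    rw [hab, dist_comm, dist_eq_norm]
    calc ‖a * b - a‖ = ‖a * (b - 1)‖ := by rw [mul_sub, mul_one]
      _ = ‖a‖ * ‖b - 1‖ := norm_mul _ _
      _ ≤ 1 * (p : ℝ) ^ (-(k : ℤ)) := mul_le_mul ha1 (norm_sub_one_le_of_toZModPow_eq_one hb1) (norm_nonneg _) zero_le_one
      _ = ((p : ℝ)⁻¹) ^ k := by rw [one_mul, zpow_neg, zpow_natCast, inv_pow]
      _ < ε := hk
  · have hσ' : τ⁻¹ * σ' ∉ (absRestrictNormalHom (rayClassField K 𝔪₀)).ker := by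
      intro h'
      apply hσ
      have e1 : τ⁻¹ * σ = (τ⁻¹ * σ') * (σ⁻¹ * σ')⁻¹ := by group
      rw [e1]; exact Subgroup.mul_mem _ h' (Subgroup.inv_mem _ hδH)
    simp only [dif_neg hσ, dif_neg hσ', dist_self]
    exact hε

/-- ★★ **The `v`-ray coset through the coordinate**: for `𝔣′ ⊆ 𝔪₀` with `v ∤ 𝔣′`,
`𝟙_{τ·Gal(K̄/K(𝔣′v^{n+1}))}(σ) = 𝟙_{z_τ(σ) ≡ 1 (p^{n+1})} · 𝟙_{τ·Gal(K̄/K(𝔣′))}(σ)` — since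
`Gal(K̄/K(𝔣′v^{n+1})) = Gal(K̄/K(𝔪₀v^{n+1})) ∩ Gal(K̄/K(𝔣′))` (`absRayAdicTower_U_eq_inf`) and the first
factor is cut out by `κ_v ≡ 1 (v^{n+1})`. [cite: deShalit1987, II.1.9 (p. 43), II.4.17 (p. 77–78)]
[cite: NeukirchANT1999, Ch. VI §6 (6.7)] -/
theorem ite_mem_absRayAdicTower_eq {𝕜 : Type*} [NormedField 𝕜] {𝔣' : Ideal (𝓞 K)} (h𝔣' : 𝔣' ≠ ⊥)
    (hle : 𝔣' ≤ 𝔪₀) (hv' : ¬ 𝔣' ≤ v.asIdeal) (τ σ : absoluteGaloisGroup K) (n : ℕ) :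
    (if τ⁻¹ * σ ∈ (absRayAdicTower h𝔣' v).U n then (1 : 𝕜) else 0) =
      (if PadicInt.toZModPow (n + 1)
          (if h' : τ⁻¹ * σ ∈ (absRestrictNormalHom (rayClassField K 𝔪₀)).ker then
            e (((rayAdicCharacter h𝔪₀ hv hw ⟨τ⁻¹ * σ, h'⟩)⁻¹ : (v.adicCompletionIntegers K)ˣ) :
              v.adicCompletionIntegers K) else 0) = 1 then (1 : 𝕜) else 0) *
        (if τ⁻¹ * σ ∈ (absRestrictNormalHom (rayClassField K 𝔣')).ker then (1 : 𝕜) else 0) := by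
  by_cases hG : τ⁻¹ * σ ∈ (absRestrictNormalHom (rayClassField K 𝔣')).ker
  · have hH : τ⁻¹ * σ ∈ (absRestrictNormalHom (rayClassField K 𝔪₀)).ker :=
      ker_absRestrictNormalHom_rayClassField_anti h𝔣' hle hG
    rw [if_pos hG, mul_one]
    have hiff : τ⁻¹ * σ ∈ (absRayAdicTower h𝔣' v).U n ↔ τ⁻¹ * σ ∈ (absRayAdicTower h𝔪₀ v).U n := by
      rw [absRayAdicTower_U_eq_inf h𝔪₀ h𝔣' v hle hv' hw n, Subgroup.mem_inf]
      exact ⟨fun h ↦ h.1, fun h ↦ ⟨h, hG⟩⟩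
    have hz := toZModPow_coord_eq_one_iff h𝔪₀ hv hw e τ σ hH n
    by_cases hmem : τ⁻¹ * σ ∈ (absRayAdicTower h𝔪₀ v).U n
    · rw [if_pos (hiff.mpr hmem), if_pos (hz.mpr hmem)]
    · rw [if_neg (fun h ↦ hmem (hiff.mp h)), if_neg (fun h ↦ hmem (hz.mp h))]
  · rw [if_neg hG, mul_zero, if_neg]
    exact fun h ↦ hG (absRayAdicTower_U_le_ker h𝔣' v le_rfl n h)

end Coord

end Summit.BirchSwinnertonDyer.BirchSwinnertonDyer.Theorems.PrintCf2.KatzJZeroUnique
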